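import Literature.AlgebraicGeometry.Motives.UniversalHypersurfaceFibre
import Literature.AlgebraicGeometry.Motives.ProjectiveSpaceLinearSubst
import Literature.AlgebraicGeometry.Motives.HypersurfaceFieldPoints
import Literature.AlgebraicGeometry.HodgeTheory.UniversalHypersurfaceEhresmann
import HarnessLib

/-!
# The diagonal torus acts on the universal hypersurface

Family `hodge`, layer `Literature/AlgebraicGeometry/Motives`. Part of the definition request
`defn-MonomialSupportedHypersurfaceFamily` (crux K1-B `stub_signPencilOrbitData` of route
SignSymmetricPowers: the relative automorphism `sigmaM` of the monomial-supported family, built in the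
companion `Motives/MonomialSupportedHypersurfaceSymmetry` from the action constructed here).

Let `R = k[a_m | |m| = d]` be the coefficient ring of the universal form `F = Σ_m a_m x^m` of degree `d`
in `x₀, …, x_{n+1}` and `𝒴 = V₊(F) ⊆ ℙⁿ⁺¹_R` the universal hypersurface over the affine space of forms
`S^d = Spec R` (file `Motives/UniversalHypersurfaceFamily`). A diagonal matrix of units
`γ = diag(γ₀, …, γ_{n+1})`, `γᵢ ∈ kˣ`, acts

* on `ℙⁿ⁺¹_k` by `[z] ↦ [γ • z]` (`diagProjMap`, the tree's `ProjectiveSpace.substMap` of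
  `xᵢ ↦ γᵢ xᵢ`; over `ℂ` this is literally `HodgeTheory.diagonalProjMap γ`);
* on the space of forms by `a_m ↦ γ^{-m} a_m` (`coeffScale`, `Spec` of it `specCoeffScale`), so that
  `F(γ • x)` with rescaled coefficients is again `F`;
* hence on `ℙⁿ⁺¹_R = ℙⁿ⁺¹_k ×_k S^d` diagonally: this is `Proj` of the **semilinear** graded ring
  endomorphism `Φ_γ : R[x] → R[x]`, `xᵢ ↦ γᵢ xᵢ`, `a_m ↦ γ^{-m} a_m` (`torusHom`, `torusGraded`,
  `torusProj`), under which **the universal form is invariant** (`torusHom_universalForm`).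

## What is proved

* `torusProj_comp_projSpToSpec`: `P_γ = Proj Φ_γ` covers `Spec β_γ` on `S^d` (chartwise, Mathlib
  `Proj.awayι_comp_map`); `torusProj_comp_projSpToProjSp`: `P_γ` covers `[z] ↦ [γ • z]` on `ℙⁿ⁺¹_k`
  (functoriality `Proj.map_comp`).
* `isReduced_totalSpace`: `𝒴` (reduced induced structure) is reduced; `torusTotal`: **the action
  `σ̃_γ : 𝒴 → 𝒴`** (restriction of `P_γ`, by the universal property of the reduced induced structure,
  `Motives.liftOfRangeSubset`), with `torusTotal_comp_totalι` and `torusTotal_comp_totalToSpec`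
  (`σ̃_γ` covers `Spec β_γ`): the universal hypersurface `𝒴 → S^d` is equivariant for the diagonal torus
  (Katz 2009, §3, for the Dwork family: "the group `Γ_W` acts as automorphisms of `X/𝔸¹`").

## Design

* The action on coefficients is needed because `F` is not invariant under `xᵢ ↦ γᵢxᵢ` alone; with
  `a_m ↦ γ^{-m}a_m` every term `a_m x^m` is invariant, for every `γ`, with no condition on the monomials.
  On a subfamily of `M`-supported forms with `γ^m = 1` (`m ∈ M`) the coefficient action is trivial, which
  is how the companion file obtains an automorphism OVER the base.
* NOT here: the group law `σ̃_γ σ̃_{γ'} = σ̃_{γγ'}` (not needed by the consumer), invariance of the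
  discriminant / of `U` under `Spec β_γ` (not needed: the companion works over the image of `𝔸^M`, fixed
  pointwise).

## References

* N. M. Katz, *Another look at the Dwork family*, in: Algebra, Arithmetic, and Geometry, Progr. Math. 269
  (2009), §3 (diagonal group acting on a family of hypersurfaces over its parameter space). [Katz2009]
* R. Hartshorne, *Algebraic Geometry* (1977), II Ex. 2.14 (functoriality of `Proj`), II Example 7.1.1
  (automorphisms of `ℙⁿ` from linear substitutions), II Example 3.2.6 (reduced induced structure).
  [Hartshorne1977]
* Q. Liu, *Algebraic Geometry and Arithmetic Curves* (2002), Prop. 3.1.9 (`Proj` and base change).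
  [Liu2002]
-/

noncomputable section

open CategoryTheory AlgebraicGeometry MvPolynomial Limits HomogeneousLocalization

universe u

namespace Literature.AlgebraicGeometry.Motives.UniversalHypersurface

section Torus

variable (k : Type u) [Field k] (n d : ℕ) (γ : Fin (n + 2) → kˣ)

/-- The weight `γ^m = ∏ᵢ γᵢ^{mᵢ} ∈ kˣ` of an exponent `m` under the diagonal `γ`. [cite: Katz2009, §3] -/
def unitWeight (m : Fin (n + 2) →₀ ℕ) : kˣ := m.prod fun i e => γ i ^ e

/-- `γ^m` as an element of `k`. [cite: Katz2009, §3] -/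
theorem unitWeight_coe (m : Fin (n + 2) →₀ ℕ) :
    ((unitWeight k n γ m : kˣ) : k) = m.prod fun i e => (γ i : k) ^ e := by
  simp [unitWeight, Finsupp.prod]

/-- `(γ⁻¹)^m = (γ^m)⁻¹`. [cite: Katz2009, §3] -/
theorem unitWeight_inv (m : Fin (n + 2) →₀ ℕ) :
    unitWeight k n γ⁻¹ m = (unitWeight k n γ m)⁻¹ := by
  simp [unitWeight, Finsupp.prod]

/-- The coefficient scaling `β_γ : R → R`, `a_m ↦ γ^{-m} a_m` (a `k`-algebra endomorphism of
`R = k[a_m]`). [cite: Katz2009, §3] -/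
def coeffScale : CoeffRing k n d →ₐ[k] CoeffRing k n d :=
  aeval fun m : DegIndex n d => C ((unitWeight k n γ m.1)⁻¹ : kˣ).val * X m

/-- `β_γ (a_m) = γ^{-m} a_m`. [cite: Katz2009, §3] -/
@[simp]
theorem coeffScale_X (m : DegIndex n d) :
    coeffScale k n d γ (X m) = C ((unitWeight k n γ m.1)⁻¹ : kˣ).val * X m := by
  rw [coeffScale, aeval_X]

/-- `β_γ` fixes the constants. [cite: Katz2009, §3] -/
theorem coeffScale_C (r : k) : coeffScale k n d γ (C r) = C r := by
  rw [← MvPolynomial.algebraMap_eq, AlgHom.commutes]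

/-- `β_γ ∘ β_{γ⁻¹} = id`. [cite: Katz2009, §3] -/
theorem coeffScale_comp_coeffScale_inv :
    (coeffScale k n d γ).comp (coeffScale k n d γ⁻¹) = AlgHom.id k _ := by
  refine MvPolynomial.algHom_ext fun m => ?_
  rw [AlgHom.comp_apply, coeffScale_X, map_mul, coeffScale_C, coeffScale_X, AlgHom.id_apply,
    ← mul_assoc, ← C_mul]
  have : (((unitWeight k n γ⁻¹ m.1)⁻¹ : kˣ).val * ((unitWeight k n γ m.1)⁻¹ : kˣ).val) = 1 := by
    rw [← Units.val_mul, unitWeight_inv, inv_inv, mul_inv_cancel, Units.val_one]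
  rw [this, C_1, one_mul]

/-- The diagonal substitution `xᵢ ↦ γᵢ xᵢ` over the coefficient ring `R`. [cite: Hartshorne1977, II Ex. 2.14] -/
def diagSubstR : Fin (n + 2) → MvPolynomial (Fin (n + 2)) (CoeffRing k n d) :=
  fun i => C (C (γ i : k)) * X i

/-- The forms `γᵢ xᵢ` are linear. [cite: Hartshorne1977, II Ex. 2.14] -/
theorem isHomogeneous_diagSubstR (i : Fin (n + 2)) : (diagSubstR k n d γ i).IsHomogeneous 1 :=
  (isHomogeneous_X _ i).C_mul _

/-- The semilinear diagonal action `Φ_γ : R[x] → R[x]`, `xᵢ ↦ γᵢ xᵢ`, `a_m ↦ γ^{-m} a_m`, as a ring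
homomorphism. [cite: Katz2009, §3] -/
def torusHom : MvPolynomial (Fin (n + 2)) (CoeffRing k n d) →+* MvPolynomial (Fin (n + 2)) (CoeffRing k n d) :=
  (aeval (diagSubstR k n d γ)).toRingHom.comp (MvPolynomial.map (coeffScale k n d γ).toRingHom)

/-- `Φ_γ` on coefficients is `β_γ`. [cite: Katz2009, §3] -/
theorem torusHom_C (r : CoeffRing k n d) : torusHom k n d γ (C r) = C (coeffScale k n d γ r) := by
  simp [torusHom]

/-- `Φ_γ (xᵢ) = γᵢ xᵢ`. [cite: Katz2009, §3] -/
theorem torusHom_X (i : Fin (n + 2)) : torusHom k n d γ (X i) = C (C (γ i : k)) * X i := by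
  simp [torusHom, diagSubstR]

/-- `Φ_γ` preserves homogeneity and degree in `x` (Mathlib `IsHomogeneous.map`, `IsHomogeneous.aeval`).
[cite: Hartshorne1977, II Ex. 2.14] -/
theorem isHomogeneous_torusHom {i : ℕ} {p : MvPolynomial (Fin (n + 2)) (CoeffRing k n d)}
    (hp : p.IsHomogeneous i) : (torusHom k n d γ p).IsHomogeneous i := by
  have h := (hp.map (coeffScale k n d γ).toRingHom).aeval (diagSubstR k n d γ)
    (isHomogeneous_diagSubstR k n d γ)
  rw [one_mul] at h
  exact h

-- `Proj R[x]` needs the grading of `R[x]` by degree as an instance; Mathlib keeps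
-- `MvPolynomial.gradedAlgebra` a def (as in every `Proj`-based file of the tree, e.g.
-- `Motives/UniversalHypersurfaceFamily`), whence the local instance attribute.
attribute [local instance] MvPolynomial.gradedAlgebra

/-- The grading of `R[x₀, …, x_{n+1}]` by degree in `x` (`R = k[a_m]`), an abbreviation for
`MvPolynomial.homogeneousSubmodule`. [cite: Hartshorne1977, II Ex. 2.14] -/
abbrev gradR : ℕ → Submodule (CoeffRing k n d) (MvPolynomial (Fin (n + 2)) (CoeffRing k n d)) :=
  MvPolynomial.homogeneousSubmodule (Fin (n + 2)) (CoeffRing k n d)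

/-- `Φ_γ` as a graded ring endomorphism of `R[x]` (grading by degree in `x`). [cite: Hartshorne1977, II Ex. 2.14] -/
def torusGraded : (gradR k n d) →+*ᵍ (gradR k n d) where
  __ := torusHom k n d γ
  map_mem {i x} hx :=
    (mem_homogeneousSubmodule i _).mpr (isHomogeneous_torusHom k n d γ ((mem_homogeneousSubmodule i x).mp hx))

/-- `torusGraded γ` is `torusHom γ` on elements (`rfl`). [cite: Hartshorne1977, II Ex. 2.14] -/
@[simp]
theorem torusGraded_apply (p : MvPolynomial (Fin (n + 2)) (CoeffRing k n d)) :
    torusGraded k n d γ p = torusHom k n d γ p := rfl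

/-- `∏ᵢ (γᵢ xᵢ)^{sᵢ} = γ^s · x^s`. [cite: Katz2009, §3] -/
theorem prod_diagSubstR_pow (s : Fin (n + 2) →₀ ℕ) :
    (s.prod fun i e => diagSubstR k n d γ i ^ e) =
      C (C ((unitWeight k n γ s : kˣ) : k)) * monomial s 1 := by
  simp only [diagSubstR, mul_pow, Finsupp.prod_mul]
  rw [unitWeight_coe, ← prod_X_pow_eq_monomial]
  congr 1
  rw [map_finsuppProd, map_finsuppProd]
  simp only [map_pow]

/-- `Φ_γ (r x^s) = (γ^s · β_γ r) x^s`. [cite: Katz2009, §3] -/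
theorem torusHom_monomial (s : Fin (n + 2) →₀ ℕ) (r : CoeffRing k n d) :
    torusHom k n d γ (monomial s r) =
      monomial s (C ((unitWeight k n γ s : kˣ) : k) * coeffScale k n d γ r) := by
  rw [torusHom, RingHom.comp_apply, map_monomial]
  simp only [AlgHom.toRingHom_eq_coe, AlgHom.coe_toRingHom]
  rw [aeval_monomial, prod_diagSubstR_pow, MvPolynomial.algebraMap_eq, ← mul_assoc, ← C_mul,
    C_mul_monomial, mul_one, mul_comm]

/-- `Φ_γ (a_m x^m) = a_m x^m`: the universal monomial terms are invariant. [cite: Katz2009, §3] -/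
theorem torusHom_monomial_X (m : DegIndex n d) :
    torusHom k n d γ (monomial m.1 (X m)) = monomial m.1 (X m) := by
  rw [torusHom_monomial, coeffScale_X, ← mul_assoc, ← C_mul, ← Units.val_mul, mul_inv_cancel,
    Units.val_one, C_1, one_mul]

/-- **The universal form is `Φ_γ`-invariant**: `Φ_γ F = F`. [cite: Katz2009, §3] -/
theorem torusHom_universalForm : torusHom k n d γ (universalForm k n d) = universalForm k n d := by
  rw [universalForm, map_sum]
  exact Finset.sum_congr rfl fun m _ => torusHom_monomial_X k n d γ m

/-- `Φ_γ ∘ Φ_{γ⁻¹} = id`. [cite: Katz2009, §3] -/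
theorem torusHom_comp_torusHom_inv :
    (torusHom k n d γ).comp (torusHom k n d γ⁻¹) = RingHom.id _ := by
  refine MvPolynomial.ringHom_ext (fun r => ?_) (fun i => ?_)
  · rw [RingHom.comp_apply, torusHom_C, torusHom_C, ← AlgHom.comp_apply,
      coeffScale_comp_coeffScale_inv, AlgHom.id_apply, RingHom.id_apply]
  · rw [RingHom.comp_apply, torusHom_X, map_mul, torusHom_C, coeffScale_C, torusHom_X,
      RingHom.id_apply, ← mul_assoc, ← C_mul, ← C_mul, Pi.inv_apply, Units.val_inv_eq_inv_val,
      inv_mul_cancel₀ (γ i).ne_zero, C_1, C_1, one_mul]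

open HomogeneousIdeal in
/-- The irrelevant ideal is generated by its image under `Φ_γ` (hypothesis of Mathlib's `Proj.map`):
every element is `Φ_γ (Φ_{γ⁻¹} x)`. [cite: Liu2002, Prop. 3.1.9] -/
theorem irrelevant_le_map_torusGraded : (gradR k n d)₊ ≤ ((gradR k n d)₊).map (torusGraded k n d γ) := by
  rw [← toIdeal_le_toIdeal_iff, irrelevant_eq_span, Ideal.span_le, toIdeal_map]
  intro x hx
  simp only [Set.mem_iUnion, SetLike.mem_coe, exists_prop] at hx
  obtain ⟨i, hi, hx⟩ := hx
  have hxe : x = torusGraded k n d γ (torusGraded k n d γ⁻¹ x) := by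
    change x = ((torusHom k n d γ).comp (torusHom k n d γ⁻¹)) x
    rw [torusHom_comp_torusHom_inv, RingHom.id_apply]
  rw [SetLike.mem_coe, hxe]
  exact Ideal.mem_map_of_mem _ (mem_irrelevant_of_mem _ hi ((torusGraded k n d γ⁻¹).map_mem hx))

/-- **The diagonal action `P_γ : ℙⁿ⁺¹_R → ℙⁿ⁺¹_R`** (`R = k[a_m]`), Mathlib `Proj.map` of the semilinear
graded map `Φ_γ`. [cite: Hartshorne1977, II Ex. 2.14] -/
def torusProj : projSp n (CoeffRing k n d) ⟶ projSp n (CoeffRing k n d) :=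
  Proj.map (torusGraded k n d γ) (irrelevant_le_map_torusGraded k n d γ)

/-- `P_γ` pulls `D₊(s)` back to `D₊(Φ_γ s)`. [cite: Hartshorne1977, II Ex. 2.14] -/
theorem torusProj_preimage_basicOpen (s : MvPolynomial (Fin (n + 2)) (CoeffRing k n d)) :
    torusProj k n d γ ⁻¹ᵁ Proj.basicOpen (gradR k n d) s = Proj.basicOpen (gradR k n d) (torusHom k n d γ s) :=
  rfl

/-- On points, `G ∈ 𝔭_{P_γ x} ↔ Φ_γ G ∈ 𝔭_x`. [cite: Hartshorne1977, II Ex. 2.14] -/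
theorem mem_torusProj_apply_iff (x : projSp n (CoeffRing k n d))
    (G : MvPolynomial (Fin (n + 2)) (CoeffRing k n d)) :
    G ∈ (torusProj k n d γ x).asHomogeneousIdeal ↔ torusHom k n d γ G ∈ x.asHomogeneousIdeal :=
  Iff.rfl

attribute [local instance] ProjBaseChange.algebraBase

/-- On `R[x]_{(s)} → R[x]_{(Φ s)}` the induced map of homogeneous localizations is `β_γ`-semilinear on
the structure maps from `R` (stated as an identity of ring homomorphisms). [cite: Liu2002, Prop. 3.1.9] -/
theorem awayMap_torusGraded_comp_algebraMap (s : MvPolynomial (Fin (n + 2)) (CoeffRing k n d)) :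
    (Away.map (torusGraded k n d γ) s).comp (algebraMap (CoeffRing k n d) (Away (gradR k n d) s)) =
      (algebraMap (CoeffRing k n d) (Away (gradR k n d) (torusGraded k n d γ s))).comp
        (coeffScale k n d γ).toRingHom := by
  refine RingHom.ext fun r => ?_
  rw [RingHom.comp_apply, RingHom.comp_apply]
  apply HomogeneousLocalization.val_injective
  rw [ProjBaseChange.val_algebraMap, ProjBaseChange.algebraMap_eq', Away.map,
    HomogeneousLocalization.map_mk, HomogeneousLocalization.val_mk]
  change Localization.mk (torusGraded k n d γ ↑(algebraMap (CoeffRing k n d) ((gradR k n d) 0) r))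
    ⟨torusGraded k n d γ 1, _⟩ = _
  simp only [SetLike.GradeZero.coe_algebraMap, MvPolynomial.algebraMap_eq, torusGraded_apply,
    torusHom_C, map_one]
  rw [← MvPolynomial.algebraMap_eq]
  change Localization.mk (algebraMap (CoeffRing k n d) (MvPolynomial (Fin (n + 2)) (CoeffRing k n d))
    (coeffScale k n d γ r)) 1 = algebraMap (CoeffRing k n d) (Localization.Away (torusGraded k n d γ s))
      (coeffScale k n d γ r)
  rw [Localization.mk_algebraMap]

/-- `Spec` of the coefficient scaling `β_γ`: the automorphism of `S^d = Spec R`. [cite: Katz2009, §3] -/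
abbrev specCoeffScale : Spec (.of (CoeffRing k n d)) ⟶ Spec (.of (CoeffRing k n d)) :=
  Spec.map (CommRingCat.ofHom (coeffScale k n d γ).toRingHom)

/-- On the chart `D₊(Φ s) → D₊(s)`: `P_γ` covers `Spec β_γ`. [cite: Liu2002, Prop. 3.1.9] -/
theorem awayι_comp_torusProj_comp_projSpToSpec {i : ℕ} (hi : 0 < i)
    (s : MvPolynomial (Fin (n + 2)) (CoeffRing k n d)) (hs : s ∈ (gradR k n d) i) :
    Proj.awayι (gradR k n d) (torusGraded k n d γ s) ((torusGraded k n d γ).map_mem hs) hi ≫ torusProj k n d γ ≫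
        projSpToSpec n (CoeffRing k n d) =
      Proj.awayι (gradR k n d) (torusGraded k n d γ s) ((torusGraded k n d γ).map_mem hs) hi ≫
        projSpToSpec n (CoeffRing k n d) ≫ specCoeffScale k n d γ := by
  rw [torusProj, Proj.awayι_comp_map_assoc _ _ hi s hs, ProjBaseChangeRing.awayι_projToSpec,
    ← Category.assoc, ProjBaseChangeRing.awayι_projToSpec, ← Spec.map_comp, ← Spec.map_comp,
    ← CommRingCat.ofHom_comp, ← CommRingCat.ofHom_comp]
  congr 2
  exact awayMap_torusGraded_comp_algebraMap k n d γ s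

/-- **`P_γ` covers `Spec β_γ` on `S^d`**: `P_γ ≫ (ℙ_R → S^d) = (ℙ_R → S^d) ≫ Spec β_γ`. [cite: Liu2002,
Prop. 3.1.9] -/
theorem torusProj_comp_projSpToSpec :
    torusProj k n d γ ≫ projSpToSpec n (CoeffRing k n d) =
      projSpToSpec n (CoeffRing k n d) ≫ specCoeffScale k n d γ := by
  refine (Proj.mapAffineOpenCover (torusGraded k n d γ)
    (irrelevant_le_map_torusGraded k n d γ)).openCover.hom_ext _ _ fun s => ?_
  rw [Scheme.AffineOpenCover.openCover_f, Proj.mapAffineOpenCover_f]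
  exact awayι_comp_torusProj_comp_projSpToSpec k n d γ s.1.2 s.2 s.2.2

/-! #### Compatibility with `ℙ_R → ℙ_k` and the diagonal transformation of `ℙ_k` -/

/-- The diagonal substitution `xᵢ ↦ γᵢ xᵢ` over `k`. [cite: Hartshorne1977, II Example 7.1.1] -/
def diagSubstK : Fin (n + 2) → MvPolynomial (Fin (n + 2)) k := fun i => C (γ i : k) * X i

/-- The forms `γᵢ xᵢ ∈ k[x]` are linear. [cite: Hartshorne1977, II Example 7.1.1] -/
theorem isHomogeneous_diagSubstK (i : Fin (n + 2)) : (diagSubstK k n γ i).IsHomogeneous 1 :=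
  (isHomogeneous_X k i).C_mul _

/-- `σ_γ ∘ σ_{γ⁻¹} = id` on `k[x]`. [cite: Hartshorne1977, II Example 7.1.1] -/
theorem aeval_diagSubstK_aeval_diagSubstK_inv (p : MvPolynomial (Fin (n + 2)) k) :
    aeval (diagSubstK k n γ) (aeval (diagSubstK k n γ⁻¹) p) = p := by
  have h : (fun i => aeval (diagSubstK k n γ) (diagSubstK k n γ⁻¹ i)) = X := by
    funext i
    simp only [diagSubstK, map_mul, aeval_C, algebraMap_eq, aeval_X, Pi.inv_apply,
      Units.val_inv_eq_inv_val, ← mul_assoc, ← C_mul, inv_mul_cancel₀ (γ i).ne_zero, C_1, one_mul]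
  rw [← AlgHom.comp_apply, MvPolynomial.comp_aeval, h, aeval_X_left, AlgHom.id_apply]

/-- **The diagonal projective transformation `[z] ↦ [γ • z]` of `ℙⁿ⁺¹_k`** (tree `ProjectiveSpace.substMap`;
over `ℂ` this is `HodgeTheory.diagonalProjMap γ`). [cite: Hartshorne1977, II Example 7.1.1] -/
def diagProjMap : Motives.projectiveSpace (n + 1) k ⟶ Motives.projectiveSpace (n + 1) k :=
  ProjectiveSpace.substMap (diagSubstK k n γ) (isHomogeneous_diagSubstK k n γ) (diagSubstK k n γ⁻¹)
    (isHomogeneous_diagSubstK k n γ⁻¹) (aeval_diagSubstK_aeval_diagSubstK_inv k n γ)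

/-- `Φ_γ ∘ (k[x] → R[x]) = (k[x] → R[x]) ∘ σ_γ`: the semilinear action restricts to the diagonal
substitution on constants-from-`k` polynomials. [cite: Hartshorne1977, II Ex. 2.14] -/
theorem torusHom_comp_map_algebraMap :
    (torusHom k n d γ).comp (MvPolynomial.map (algebraMap k (CoeffRing k n d))) =
      (MvPolynomial.map (algebraMap k (CoeffRing k n d))).comp (aeval (diagSubstK k n γ)).toRingHom := by
  refine MvPolynomial.ringHom_ext (fun c => ?_) (fun i => ?_)
  · rw [RingHom.comp_apply, RingHom.comp_apply, map_C, torusHom_C, AlgHom.commutes,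
      AlgHom.toRingHom_eq_coe, AlgHom.coe_toRingHom, aeval_C]
    simp only [MvPolynomial.algebraMap_eq, map_C]
  · rw [RingHom.comp_apply, RingHom.comp_apply, map_X, torusHom_X, AlgHom.toRingHom_eq_coe,
      AlgHom.coe_toRingHom, aeval_X, diagSubstK, map_mul, map_C, map_X, MvPolynomial.algebraMap_eq]

/-- **`P_γ` covers the diagonal transformation of `ℙⁿ⁺¹_k`**: `P_γ ≫ (ℙ_R → ℙ_k) = (ℙ_R → ℙ_k) ≫ [z ↦ γ • z]`
(functoriality of `Proj`, Mathlib `Proj.map_comp`). [cite: Hartshorne1977, II Ex. 2.14] -/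
theorem torusProj_comp_projSpToProjSp :
    torusProj k n d γ ≫ HodgeTheory.UniversalHypersurface.projSpToProjSp k n d =
      HodgeTheory.UniversalHypersurface.projSpToProjSp k n d ≫ (diagProjMap k n γ).left := by
  have key : (torusGraded k n d γ).comp (ProjBaseChangeRing.mapGraded k (CoeffRing k n d) (Fin (n + 2))) =
      (ProjBaseChangeRing.mapGraded k (CoeffRing k n d) (Fin (n + 2))).comp
        (ProjectiveSpace.substGraded (diagSubstK k n γ) (isHomogeneous_diagSubstK k n γ)) := by
    refine DFunLike.ext _ _ fun p => ?_
    exact RingHom.congr_fun (torusHom_comp_map_algebraMap k n d γ) p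
  -- `Proj.map` only depends on the graded homomorphism (the irrelevance hypothesis is a proof)
  have hmap : ∀ (f g : MvPolynomial.homogeneousSubmodule (Fin (n + 2)) k →+*ᵍ (gradR k n d)) (hf hg), f = g →
      Proj.map f hf = Proj.map g hg := by
    rintro f g hf hg rfl
    rfl
  calc torusProj k n d γ ≫ HodgeTheory.UniversalHypersurface.projSpToProjSp k n d
      = Proj.map ((torusGraded k n d γ).comp (ProjBaseChangeRing.mapGraded k (CoeffRing k n d) (Fin (n + 2)))) _ :=
        (Proj.map_comp _ _ (ProjBaseChangeRing.irrelevant_le_map k (CoeffRing k n d) (Fin (n + 2)))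
          (irrelevant_le_map_torusGraded k n d γ)).symm
    _ = Proj.map ((ProjBaseChangeRing.mapGraded k (CoeffRing k n d) (Fin (n + 2))).comp
          (ProjectiveSpace.substGraded (diagSubstK k n γ) (isHomogeneous_diagSubstK k n γ)))
          (HomogeneousIdeal.irrelevant_le_map_comp
            (ProjectiveSpace.irrelevant_le_map_substGraded (diagSubstK k n γ) (isHomogeneous_diagSubstK k n γ)
              (diagSubstK k n γ⁻¹) (isHomogeneous_diagSubstK k n γ⁻¹) (aeval_diagSubstK_aeval_diagSubstK_inv k n γ))
            (ProjBaseChangeRing.irrelevant_le_map k (CoeffRing k n d) (Fin (n + 2)))) :=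
        hmap _ _ _ _ key
    _ = HodgeTheory.UniversalHypersurface.projSpToProjSp k n d ≫ (diagProjMap k n γ).left :=
        Proj.map_comp _ _ _ _

/-! #### The action on the universal hypersurface `𝒴 = V₊(F) ⊆ ℙ_R` -/

/-- The universal hypersurface `𝒴` (reduced induced structure on `V₊(F)`) is reduced. [cite:
Hartshorne1977, II Example 3.2.6] -/
theorem isReduced_totalSpace : IsReduced (totalSpace k n d) := by
  change IsReduced (idealSheaf k n d).subscheme
  haveI : ∀ U, IsReduced ((idealSheaf k n d).subschemeCover.openCover.X U) := by
    intro (U : (projSp n (CoeffRing k n d)).affineOpens)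
    change IsReduced (Spec (.of (Γ(_, (U : (projSp n (CoeffRing k n d)).Opens)) ⧸
      (idealSheaf k n d).ideal U)))
    haveI : _root_.IsReduced (Γ(_, (U : (projSp n (CoeffRing k n d)).Opens)) ⧸
        (idealSheaf k n d).ideal U) := by
      rw [← Ideal.isRadical_iff_quotient_reduced, idealSheaf,
        Scheme.IdealSheafData.vanishingIdeal_ideal]
      exact PrimeSpectrum.isRadical_vanishingIdeal _
    infer_instance
  exact IsReduced.of_openCover _ (idealSheaf k n d).subschemeCover.openCover

/-- `P_γ` maps `V₊(F)` into itself (`Φ_γ F = F`). [cite: Katz2009, §3] -/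
theorem range_totalι_comp_torusProj_subset :
    Set.range (totalι k n d ≫ torusProj k n d γ) ⊆ Set.range (totalι k n d) := by
  rintro _ ⟨y, rfl⟩
  rw [range_totalι]
  have hy : totalι k n d y ∈ ProjectiveSpectrum.zeroLocus (gradR k n d) {universalForm k n d} := by
    rw [← range_totalι]; exact ⟨y, rfl⟩
  rw [Scheme.Hom.comp_apply]
  refine Set.singleton_subset_iff.mpr ?_
  rw [SetLike.mem_coe, mem_torusProj_apply_iff, torusHom_universalForm]
  exact Set.singleton_subset_iff.mp hy

/-- **The diagonal action `σ̃_γ : 𝒴 → 𝒴` on the universal hypersurface** (restriction of `P_γ` to the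
reduced closed subscheme `V₊(F)`, by the universal property of the reduced induced structure). [cite: Katz2009, §3] -/
def torusTotal : totalSpace k n d ⟶ totalSpace k n d :=
  haveI := isReduced_totalSpace k n d
  liftOfRangeSubset (totalι k n d) (totalι k n d ≫ torusProj k n d γ)
    (range_totalι_comp_torusProj_subset k n d γ)

/-- `σ̃_γ ≫ (𝒴 ↪ ℙ_R) = (𝒴 ↪ ℙ_R) ≫ P_γ`. [cite: Katz2009, §3] -/
@[reassoc]
theorem torusTotal_comp_totalι :
    torusTotal k n d γ ≫ totalι k n d = totalι k n d ≫ torusProj k n d γ :=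
  haveI := isReduced_totalSpace k n d
  liftOfRangeSubset_comp _ _ _

/-- **`σ̃_γ` covers `Spec β_γ` on the space of forms**: `σ̃_γ ≫ (𝒴 → S^d) = (𝒴 → S^d) ≫ Spec β_γ`. [cite:
Katz2009, §3] -/
@[reassoc]
theorem torusTotal_comp_totalToSpec :
    torusTotal k n d γ ≫ totalToSpec k n d = totalToSpec k n d ≫ specCoeffScale k n d γ := by
  rw [totalToSpec, Category.assoc, torusTotal_comp_totalι_assoc, torusProj_comp_projSpToSpec]

end Torus

end Literature.AlgebraicGeometry.Motives.UniversalHypersurface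

end
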